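import Literature.Barriers.CriticalPhenomena.SupercriticalSAWSpaceFilling
import HarnessLib

/-!
# Space-filling families do not converge to a curve that misses a ball: the mechanism of the
# barrier `SupercriticalSAWSpaceFilling`, proved (`¬ RobustSAWScalingLimit` from its inputs)

Topic `Literature/Barriers/CriticalPhenomena`; companion of `SupercriticalSAWSpaceFilling`, which
vendors Theorem 1 of H. Duminil-Copin, G. Kozma, A. Yadin, *Supercritical self-avoiding walks are
space-filling*, Ann. IHP Probab. Stat. 50 (2014) 315–326 (arXiv:1110.3074) as the named fact
`SupercriticalSAW.DKY2014_thm1`, the printed weak notion of a space-filling family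
`SupercriticalSAW.IsSpaceFillingFamily` (§1, p. 2: "for any open set `U ⊂ Ω`,
`P_{(Ω_δ,a_δ,b_δ,x)}[γ_δ ∩ U = ∅] → 0`"), and the strengthening of the sub-problem that the
barrier obstructs, `SupercriticalSAW.RobustSAWScalingLimit` (SLE_{8/3} convergence for all
fugacities `x` in a neighbourhood of `x_c = 1/μ`).

`RobustSAWScalingLimit` is **not** a result of the source (nor of anyone): it implies the open
sub-problem `Literature.Probability.RandomPlanarGeometry.SAW.SAWScalingLimit` (`RobustSAWScalingLimit.sawScalingLimit`), and for
`x_c < x < x_c + ε` it asserts an SLE_{8/3} limit in the regime where the source proves the walk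
space-filling (Theorem 1) and conjectures SLE₈ (Conjecture 11, p. 8). This file proves the
logical mechanism by which Theorem 1 obstructs it, with every analytic input an explicit
hypothesis over the library's own predicates (no new named facts):

* `IsSpaceFillingFamily.not_convergesInLawToSLE` — **the core lemma**: if the laws
  `P_δ = lawAt x Ω_δ (A δ) (B δ)` form a space-filling family in `Ω = D.carrier` (weak sense of
  §1) and every chordal SLE_κ random curve `Γ` of `(D; a, b)` misses some ball `B(z, 2r)`,
  `B(z, r) ⊆ Ω`, with positive pre-Wiener probability, then `γ_δ ↦ γ_δ.curve` does NOT converge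
  in law to chordal SLE_κ (`Literature.Probability.RandomPlanarGeometry.ConvergesInLawToSLE`). Proof: the bounded `1/r`-Lipschitz test
  functional `F(c) = g(dist(z, trace c))`, `g = 0` on `[0, r]`, `g = 1` on `[2r, ∞)`
  (`missFunctional`), has `∫ F dP_δ ≤ P_δ[no visited mesh point in B(z, r)] → 0` (the mesh points
  of `γ_δ` lie on its polyline) while `∫ F(Γ) dW ≥ W[Γ misses B(z, 2r)] > 0`; `TendstoLaw` makes
  the two limits equal (one-sided portmanteau by hand, Billingsley 1999, Thm 2.1).
* `not_sawScalingLimitAt_of_isSpaceFillingFamily`, `not_robustSAWScalingLimit_of_isSpaceFillingFamily`,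
  `not_robustSAWScalingLimit_of_unitDisc` — the corollaries for `SAWScalingLimitAt x` and
  `RobustSAWScalingLimit` (via `RobustSAWScalingLimit.supercritical`), the last one in the setting
  of Theorem 1 (the unit disc `DobrushinDomain.unitDisc`, whose carrier is
  `SupercriticalSAW.unitDisk` by `rfl`).

What lies between these corollaries and `DKY2014_thm1 → … → ¬ RobustSAWScalingLimit` is NOT
proved in this file, which is kept as the bare mechanism with explicit hypotheses; all of it has
since been discharged elsewhere in the catalogue (audit gen 33, 2026-08-17 — this paragraph
formerly read "recorded, not claimed"): (i) Theorem 1 (holes of `𝔻_δ ∖ Γ_δ^ξ` have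
`≤ c log(1/δ)` sites) implies the weak space-filling of §1 in the disc (a ball of radius `r`
avoided by the walk contains a digital segment of `≍ r/δ` sites — indeed a digital square of
`≍ (r/δ)²` sites — of one component of the hole graph once `δ ξ < r/2`, `8δ ≤ r`):
`SupercriticalSAW.isSpaceFillingFamily_of_DKY2014_thm1` (`…Refutation`, via
`SupercriticalSAW.hasLargeHole_of_forall_notMem_ball`; the square in `…WindowRateQuarter`), and
Theorem 1 itself is proved, `SupercriticalSAW.DKY2014_thm1_holds` (`…TilesTheorem6`); (ii) the
closest sites `a_δ, b_δ` of Theorem 1 exist at every mesh and form an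
`Literature.Probability.RandomPlanarGeometry.SAW.IsEndpointApprox` of the disc:
`SupercriticalSAW.exists_closestSiteFamily`, `SupercriticalSAW.isEndpointApprox_unitDisc_of_isClosestSite`
(`…Problem10`); (iii) chordal SLE_{8/3} misses a ball with positive probability:
`Literature.Probability.RandomPlanarGeometry.IsSLECurve.exists_ball_measure_disjoint_ne_zero`
(`Literature/Probability/RandomPlanarGeometry/SLEEightThirdsMissesBall.lean`, from [LSW03]
Thm. 6.1, `Literature.Probability.RandomPlanarGeometry.sle_restriction_eightThirds`, and the
simplicity of the trace for `κ ≤ 4`,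
`Literature.Probability.RandomPlanarGeometry.ae_isSimpleTrace_sleTrace_of_le_four`, both of which
are now theorems of the tree: `Literature.Probability.RandomPlanarGeometry.sle_restriction_eightThirds_holds`,
`Literature.Probability.RandomPlanarGeometry.ae_isSimpleTrace_sleTrace_of_le_four_holds`) — and
the restriction formula is not even needed: a simple curve covers no open set, so the sharper
mechanism of `…ProofsNarrow` / `…Unconditional` runs on the simplicity theorem alone; finally
the hypothesis `hW` of the core lemma is the theorem
`Literature.Probability.RandomPlanarGeometry.isProjectiveLimit_preWienerMeasure_holds`. The
hypothesis-free forms of the corollaries below are `SupercriticalSAW.not_sawScalingLimitAt_of_lt`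
(every `x > x_c`) and `SupercriticalSAW.not_robustSAWScalingLimit` (`…Unconditional`, axioms
`propext`, `Classical.choice`, `Quot.sound`).

Mathlib: `LipschitzWith.of_le_add`, `Metric.le_infDist`, `Metric.infDist_le_infDist_add_dist`,
`BoundedContinuousFunction.mkOfBound`, `MeasureTheory.integral_indicator_one`,
`MeasureTheory.Integrable.of_bound`, `AEMeasurable.mk`, `ENNReal.tendsto_toReal`,
`tendsto_of_tendsto_of_tendsto_of_le_of_le`, `tendsto_nhds_unique`.

## References

* H. Duminil-Copin, G. Kozma, A. Yadin, *Supercritical self-avoiding walks are space-filling*,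
  Ann. Inst. Henri Poincaré Probab. Stat. 50 (2014) 315–326, arXiv:1110.3074: §1 (p. 2, the
  three phases and the weak sense of space-filling), Theorem 1 (p. 2), Problem 10 and
  Conjecture 11 (p. 8). [DuminilCopinKozmaYadin2014]
* P. Billingsley, *Convergence of probability measures*, 2nd ed. (1999), Thm 2.1 (portmanteau).
-/

noncomputable section

open MeasureTheory Filter Topology Metric Set Literature.Probability.LatticeModels Literature.Probability.Percolation Literature.Probability.RandomPlanarGeometry.SAW
open scoped ENNReal NNReal BoundedContinuousFunction

namespace Literature.Barriers.CriticalPhenomena.SupercriticalSAW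

/-! ### The distance from a point to the trace is a Lipschitz functional of the curve class -/

section TestFunctional

variable {E : Type*} [MetricSpace E]

/-- `c ↦ dist(z, trace c)` is `1`-Lipschitz for the reparametrisation distance on curve classes:
every point of one trace is within `dist c₁ c₂` of the other trace
(`Literature.Probability.RandomPlanarGeometry.Curve.infDist_range_le`). [folklore] -/
theorem lipschitzWith_infDist_range (z : E) :
    LipschitzWith 1 fun c : Literature.Probability.RandomPlanarGeometry.CurveClass E => infDist z c.range := by
  refine LipschitzWith.of_le_add fun c₁ c₂ => ?_
  obtain ⟨γ₁, rfl⟩ := Literature.Probability.RandomPlanarGeometry.CurveClass.surjective_mk c₁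
  obtain ⟨γ₂, rfl⟩ := Literature.Probability.RandomPlanarGeometry.CurveClass.surjective_mk c₂
  simp only [Literature.Probability.RandomPlanarGeometry.CurveClass.range_mk, Literature.Probability.RandomPlanarGeometry.CurveClass.dist_mk_mk]
  have key : ∀ ⦃y⦄, y ∈ γ₂.range → infDist z γ₁.range - dist γ₁ γ₂ ≤ dist z y := by
    rintro y ⟨t, rfl⟩
    have h₁ := Literature.Probability.RandomPlanarGeometry.Curve.infDist_range_le γ₂ γ₁ t
    have h₂ := infDist_le_infDist_add_dist (s := γ₁.range) (x := z) (y := γ₂ t)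
    rw [dist_comm γ₂ γ₁] at h₁
    linarith
  have h := (le_infDist γ₂.range_nonempty).2 key
  linarith

/-- The ramp profile `g_r(t) = min 1 (max 0 (t / r - 1))`: continuous, with values in `[0, 1]`,
equal to `0` for `t ≤ r` and to `1` for `t ≥ 2r` (when `r > 0`). [folklore] -/
def missProfile (r t : ℝ) : ℝ :=
  min 1 (max 0 (t / r - 1))

/-- `0 ≤ g_r`. [folklore] -/
theorem missProfile_nonneg (r t : ℝ) : 0 ≤ missProfile r t :=
  le_min zero_le_one (le_max_left _ _)

/-- `g_r ≤ 1`. [folklore] -/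
theorem missProfile_le_one (r t : ℝ) : missProfile r t ≤ 1 :=
  min_le_left _ _

/-- `g_r` is continuous. [folklore] -/
theorem continuous_missProfile (r : ℝ) : Continuous (missProfile r) :=
  continuous_const.min (continuous_const.max ((continuous_id.div_const r).sub continuous_const))

/-- `g_r(t) = 0` for `t ≤ r` (`r > 0`). [folklore] -/
theorem missProfile_eq_zero {r t : ℝ} (hr : 0 < r) (ht : t ≤ r) : missProfile r t = 0 := by
  have h : t / r - 1 ≤ 0 := by
    rw [sub_nonpos, div_le_one hr]
    exact ht
  rw [missProfile, max_eq_left h, min_eq_right zero_le_one]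

/-- `g_r(t) = 1` for `t ≥ 2r` (`r > 0`). [folklore] -/
theorem missProfile_eq_one {r t : ℝ} (hr : 0 < r) (ht : 2 * r ≤ t) : missProfile r t = 1 := by
  have h : 1 ≤ t / r - 1 := by
    rw [le_sub_iff_add_le, le_div_iff₀ hr]
    linarith
  rw [missProfile, min_eq_left (h.trans (le_max_right _ _))]

/-- **The test functional** `F_{z,r}(c) = g_r(dist(z, trace c))` on curve classes: bounded (values
in `[0, 1]`) and continuous (`lipschitzWith_infDist_range`); `F = 1` on curves missing the ball
`B(z, 2r)` and `F = 0` on curves meeting the closed ball of radius `r`. The bounded continuous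
function fed to `Literature.Probability.RandomPlanarGeometry.TendstoLaw` in the portmanteau step. [folklore] -/
def missFunctional (z : E) (r : ℝ) : Literature.Probability.RandomPlanarGeometry.CurveClass E →ᵇ ℝ :=
  BoundedContinuousFunction.mkOfBound
    ⟨fun c => missProfile r (infDist z c.range),
      (continuous_missProfile r).comp (lipschitzWith_infDist_range z).continuous⟩
    1 fun c₁ c₂ => by
      simp only [ContinuousMap.coe_mk, Real.dist_eq]
      have h₁ := missProfile_nonneg r (infDist z c₁.range)
      have h₂ := missProfile_le_one r (infDist z c₁.range)
      have h₃ := missProfile_nonneg r (infDist z c₂.range)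
      have h₄ := missProfile_le_one r (infDist z c₂.range)
      rw [abs_le]
      constructor <;> linarith

/-- Value of the test functional. [folklore] -/
theorem missFunctional_apply (z : E) (r : ℝ) (c : Literature.Probability.RandomPlanarGeometry.CurveClass E) :
    missFunctional z r c = missProfile r (infDist z c.range) := rfl

/-- `0 ≤ F`. [folklore] -/
theorem missFunctional_nonneg (z : E) (r : ℝ) (c : Literature.Probability.RandomPlanarGeometry.CurveClass E) : 0 ≤ missFunctional z r c :=
  missProfile_nonneg _ _

/-- `F ≤ 1`. [folklore] -/
theorem missFunctional_le_one (z : E) (r : ℝ) (c : Literature.Probability.RandomPlanarGeometry.CurveClass E) : missFunctional z r c ≤ 1 :=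
  missProfile_le_one _ _

/-- A curve whose trace misses the ball `B(z, 2r)` has `F = 1`. [folklore] -/
theorem missFunctional_eq_one {z : E} {r : ℝ} (hr : 0 < r) {c : Literature.Probability.RandomPlanarGeometry.CurveClass E}
    (h : Disjoint (ball z (2 * r)) c.range) : missFunctional z r c = 1 := by
  rw [missFunctional_apply]
  refine missProfile_eq_one hr ((le_infDist c.range_nonempty).2 fun y hy => ?_)
  by_contra hlt
  exact (Set.disjoint_left.1 h (mem_ball'.2 (not_le.1 hlt))) hy

/-- A curve whose trace has a point within distance `< r` of `z` has `F = 0`; equivalently,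
`F c ≠ 0` forces the trace to miss the ball `B(z, r)`. [folklore] -/
theorem missFunctional_eq_zero {z : E} {r : ℝ} (hr : 0 < r) {c : Literature.Probability.RandomPlanarGeometry.CurveClass E} {y : E}
    (hy : y ∈ c.range) (hyz : dist y z < r) : missFunctional z r c = 0 := by
  rw [missFunctional_apply]
  refine missProfile_eq_zero hr ?_
  rw [dist_comm] at hyz
  exact ((infDist_le_dist_of_mem hy).trans hyz.le)

end TestFunctional

/-! ### The SAW law with parameter `x` is zero or a probability measure -/

section Law

variable {Ω : Set ℂ} {δ : ℝ} {a b : Site 2}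

/-- `P_{(Ω_δ,a_δ,b_δ,x)} = Z(x)⁻¹ · (x^{|γ|})_γ` is either the zero measure (no walk, or infinite
total weight — the junk cases of `lawAt`) or a probability measure.
[cite: DuminilCopinKozmaYadin2014, §1 (definition of P_{(Ω_δ,a_δ,b_δ,x)})] -/
theorem lawAt_eq_zero_or_isProbabilityMeasure (x : ℝ) (Ω : Set ℂ) (δ : ℝ) (a b : Site 2) :
    lawAt x Ω δ a b = 0 ∨ IsProbabilityMeasure (lawAt x Ω δ a b) := by
  unfold lawAt
  set w := weightAt x Ω δ a b
  rcases eq_or_ne (w univ) 0 with h0 | h0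
  · left
    rw [Measure.measure_univ_eq_zero.1 h0, smul_zero]
  rcases eq_or_ne (w univ) ∞ with htop | htop
  · left
    rw [htop, ENNReal.inv_top, zero_smul]
  · right
    refine ⟨?_⟩
    rw [Measure.smul_apply, smul_eq_mul, ENNReal.inv_mul_cancel h0 htop]

/-- In particular `P_{(Ω_δ,a_δ,b_δ,x)}` is a finite measure.
[cite: DuminilCopinKozmaYadin2014, §1 (definition of P_{(Ω_δ,a_δ,b_δ,x)})] -/
instance isFiniteMeasure_lawAt (x : ℝ) (Ω : Set ℂ) (δ : ℝ) (a b : Site 2) :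
    IsFiniteMeasure (lawAt x Ω δ a b) := by
  rcases lawAt_eq_zero_or_isProbabilityMeasure x Ω δ a b with h | h
  · rw [h]
    infer_instance
  · infer_instance

/-- The mesh points of the vertices visited by a SAW lie on its curve (the polyline through
them). [folklore] -/
theorem meshPoint_mem_range_curve (γ : DomainSAW Ω δ a b) {v : Site 2} (hv : v ∈ γ.walk.support) :
    meshPoint δ v ∈ γ.curve.range :=
  SimpleGraph.Walk.mem_range_toCurve (meshPoint δ) γ.walk hv

/-- **Lattice side of the portmanteau step**: for any finite measure `P` on SAWs,
`∫ F_{z,r}(γ.curve) dP ≤ P[no visited mesh point lies in B(z, r)]`, because `F_{z,r}` vanishes on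
a walk visiting a mesh point of `B(z, r)` (that point lies on the curve) and is at most `1`.
[folklore] -/
theorem integral_missFunctional_curve_le {z : ℂ} {r : ℝ} (hr : 0 < r)
    (P : Measure (DomainSAW Ω δ a b)) [IsFiniteMeasure P] :
    ∫ γ, missFunctional z r γ.curve ∂P ≤
      (P {γ | ∀ v ∈ γ.walk.support, meshPoint δ v ∉ ball z r}).toReal := by
  set S : Set (DomainSAW Ω δ a b) := {γ | ∀ v ∈ γ.walk.support, meshPoint δ v ∉ ball z r}
  have hS : MeasurableSet S := MeasurableSpace.measurableSet_top
  rw [← measureReal_def, ← integral_indicator_one hS]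
  refine integral_mono ?_ ((integrable_const (1 : ℝ)).indicator hS) fun γ => ?_
  · exact Integrable.of_bound (DomainSAW.measurable_of_top _).aestronglyMeasurable 1
      (ae_of_all _ fun γ => by
        rw [Real.norm_eq_abs, abs_of_nonneg (missFunctional_nonneg _ _ _)]
        exact missFunctional_le_one _ _ _)
  · by_cases hγ : γ ∈ S
    · rw [indicator_of_mem hγ, Pi.one_apply]
      exact missFunctional_le_one _ _ _
    · rw [indicator_of_notMem hγ]
      have hγ' : ∃ v ∈ γ.walk.support, meshPoint δ v ∈ ball z r := by
        simpa [S] using hγ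
      obtain ⟨v, hv, hvz⟩ := hγ'
      exact (missFunctional_eq_zero hr (meshPoint_mem_range_curve γ hv) (mem_ball.1 hvz)).le

end Law

/-! ### Limit side: a curve missing a ball with positive probability -/

section Limit

variable {E : Type*} [MetricSpace E] {Ω' : Type*} [MeasurableSpace Ω']

/-- **Limit side of the portmanteau step**: for a finite measure `W` and an a.e.-measurable
random curve class `Γ`, `W[trace Γ misses B(z, 2r)] ≤ ∫ F_{z,r}(Γ) dW` (`F_{z,r} = 1` on that
event, `F_{z,r} ≥ 0`; the event need not be measurable, a measurable modification of `Γ` is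
used). [folklore] -/
theorem measureReal_le_integral_missFunctional {W : Measure Ω'} [IsFiniteMeasure W]
    {Γ : Ω' → Literature.Probability.RandomPlanarGeometry.CurveClass E} (hΓ : AEMeasurable Γ W) {z : E} {r : ℝ} (hr : 0 < r) :
    (W {ω | Disjoint (ball z (2 * r)) (Γ ω).range}).toReal ≤ ∫ ω, missFunctional z r (Γ ω) ∂W := by
  set T : Set (Literature.Probability.RandomPlanarGeometry.CurveClass E) := {c | Disjoint (ball z (2 * r)) c.range}
  have hT : MeasurableSet T := by
    have : T = Literature.Probability.RandomPlanarGeometry.CurveClass.rangeSubset (ball z (2 * r))ᶜ := by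
      ext c
      simp only [T, mem_setOf_eq, Literature.Probability.RandomPlanarGeometry.CurveClass.mem_rangeSubset, subset_compl_iff_disjoint_left]
    rw [this]
    exact (Literature.Probability.RandomPlanarGeometry.CurveClass.isClosed_rangeSubset isOpen_ball.isClosed_compl).measurableSet
  have hae : Γ =ᵐ[W] hΓ.mk Γ := hΓ.ae_eq_mk
  have hE : (Γ ⁻¹' T : Set Ω') =ᵐ[W] (hΓ.mk Γ ⁻¹' T : Set Ω') := by
    filter_upwards [hae] with ω hω
    show (ω ∈ Γ ⁻¹' T) = (ω ∈ hΓ.mk Γ ⁻¹' T)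
    rw [mem_preimage, mem_preimage, hω]
  have hE' : MeasurableSet (hΓ.mk Γ ⁻¹' T) := hΓ.measurable_mk hT
  have hint : Integrable (fun ω => missFunctional z r (hΓ.mk Γ ω)) W :=
    Integrable.of_bound
      ((missFunctional z r).continuous.measurable.comp hΓ.measurable_mk).aestronglyMeasurable 1
      (ae_of_all _ fun ω => by
        rw [Real.norm_eq_abs, abs_of_nonneg (missFunctional_nonneg _ _ _)]
        exact missFunctional_le_one _ _ _)
  calc (W {ω | Disjoint (ball z (2 * r)) (Γ ω).range}).toReal
      = (W (hΓ.mk Γ ⁻¹' T)).toReal := by rw [show {ω | Disjoint (ball z (2 * r)) (Γ ω).range}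
          = Γ ⁻¹' T from rfl, measure_congr hE]
    _ = ∫ ω, (hΓ.mk Γ ⁻¹' T).indicator 1 ω ∂W := by rw [integral_indicator_one hE', measureReal_def]
    _ ≤ ∫ ω, missFunctional z r (hΓ.mk Γ ω) ∂W := by
        refine integral_mono ((integrable_const (1 : ℝ)).indicator hE') hint fun ω => ?_
        by_cases hω : ω ∈ hΓ.mk Γ ⁻¹' T
        · rw [indicator_of_mem hω, Pi.one_apply, missFunctional_eq_one hr (mem_preimage.1 hω)]
        · rw [indicator_of_notMem hω]
          exact missFunctional_nonneg _ _ _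
    _ = ∫ ω, missFunctional z r (Γ ω) ∂W := by
        refine integral_congr_ae ?_
        filter_upwards [hae] with ω hω
        rw [hω]

end Limit

/-! ### The core lemma and its corollaries -/

section Core

variable {κ : ℝ≥0} {D : Literature.Probability.RandomPlanarGeometry.DobrushinDomain} {x : ℝ} {A B : ℝ → Site 2}

/-- **Space-filling families do not converge in law to a curve that misses a ball** (the
mechanism behind the barrier `SupercriticalSAWSpaceFilling`). If the SAW laws with parameter `x`
in `Ω_δ` (`Ω = D.carrier`) from `A δ` to `B δ` are space-filling in the weak sense of
Duminil-Copin–Kozma–Yadin §1 (`IsSpaceFillingFamily`), and every chordal SLE_κ random curve `Γ`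
of `(D; a, b)` misses some ball `B(z, 2r)` with `B(z, r) ⊆ Ω` with positive pre-Wiener probability
(for `κ = 8/3`: conformal restriction / simplicity of the trace — an INPUT here), then the curves
`γ_δ.curve` do not converge in law to chordal SLE_κ in `D` (the pre-Wiener measure being a
probability measure, `isProjectiveLimit_preWienerMeasure`). One-sided portmanteau with the test
functional `missFunctional z r`. [cite: DuminilCopinKozmaYadin2014, §1 (When x > 1/μ)] -/
theorem IsSpaceFillingFamily.not_convergesInLawToSLE (hfill : IsSpaceFillingFamily x D.carrier A B)
    (hmiss : ∀ Γ : (ℝ≥0 → ℝ) → Literature.Probability.RandomPlanarGeometry.CurveClass ℂ, Literature.Probability.RandomPlanarGeometry.IsSLECurve κ D Γ →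
      ∃ z : ℂ, ∃ r : ℝ, 0 < r ∧ ball z r ⊆ D.carrier ∧
        Literature.Probability.Process.preWienerMeasure {ω | Disjoint (ball z (2 * r)) (Γ ω).range} ≠ 0)
    (hW : Literature.Probability.Process.isProjectiveLimit_preWienerMeasure) :
    ¬ Literature.Probability.RandomPlanarGeometry.ConvergesInLawToSLE κ D (fun δ (γ : DomainSAW D.carrier δ (A δ) (B δ)) => γ.curve)
        (fun δ => lawAt x D.carrier δ (A δ) (B δ)) := by
  haveI := Literature.Probability.Process.isProbabilityMeasure_preWienerMeasure hW
  rintro ⟨Γ, hΓ, -, hT⟩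
  obtain ⟨z, r, hr, hball, hpos⟩ := hmiss Γ hΓ
  -- the test integrals converge to `∫ F(Γ) dW` …
  have hlim : Tendsto (fun δ => ∫ γ, missFunctional z r (DomainSAW.curve γ)
      ∂lawAt x D.carrier δ (A δ) (B δ)) (𝓝[>] (0 : ℝ))
      (𝓝 (∫ ω, missFunctional z r (Γ ω) ∂Literature.Probability.Process.preWienerMeasure)) := hT (missFunctional z r)
  -- … and to `0`, being dominated by the avoidance probabilities of `B(z, r)`
  have hu : Tendsto (fun δ => (lawAt x D.carrier δ (A δ) (B δ)
      {γ | ∀ v ∈ γ.walk.support, meshPoint δ v ∉ ball z r}).toReal) (𝓝[>] (0 : ℝ)) (𝓝 0) := by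
    have h := (ENNReal.tendsto_toReal ENNReal.zero_ne_top).comp
      (hfill (ball z r) isOpen_ball hball ⟨z, mem_ball_self hr⟩)
    rwa [ENNReal.toReal_zero] at h
  have hzero : Tendsto (fun δ => ∫ γ, missFunctional z r (DomainSAW.curve γ)
      ∂lawAt x D.carrier δ (A δ) (B δ)) (𝓝[>] (0 : ℝ)) (𝓝 0) :=
    tendsto_of_tendsto_of_tendsto_of_le_of_le tendsto_const_nhds hu
      (fun δ => integral_nonneg fun γ => missFunctional_nonneg _ _ _)
      (fun δ => integral_missFunctional_curve_le hr _)
  have hL : ∫ ω, missFunctional z r (Γ ω) ∂Literature.Probability.Process.preWienerMeasure = 0 := tendsto_nhds_unique hlim hzero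
  have hle := measureReal_le_integral_missFunctional (W := Literature.Probability.Process.preWienerMeasure) hΓ.aemeasurable hr
    (z := z)
  rw [hL] at hle
  exact absurd hle (not_le.2 (ENNReal.toReal_pos hpos (measure_ne_top _ _)))

/-- Corollary for the sub-problem with parameter `x`: if some endpoint approximation `(A, B)` of a
Dobrushin domain `D` carries a space-filling family of SAW laws with parameter `x`, and chordal
SLE_{8/3} in `D` misses a ball with positive probability, then `SAWScalingLimitAt x` fails.
[cite: DuminilCopinKozmaYadin2014, §1 (When x > 1/μ)] -/
theorem not_sawScalingLimitAt_of_isSpaceFillingFamily (hAB : IsEndpointApprox D A B)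
    (hfill : IsSpaceFillingFamily x D.carrier A B)
    (hmiss : ∀ Γ : (ℝ≥0 → ℝ) → Literature.Probability.RandomPlanarGeometry.CurveClass ℂ, Literature.Probability.RandomPlanarGeometry.IsSLECurve ((8 : ℝ≥0) / 3) D Γ →
      ∃ z : ℂ, ∃ r : ℝ, 0 < r ∧ ball z r ⊆ D.carrier ∧
        Literature.Probability.Process.preWienerMeasure {ω | Disjoint (ball z (2 * r)) (Γ ω).range} ≠ 0)
    (hW : Literature.Probability.Process.isProjectiveLimit_preWienerMeasure) : ¬ SAWScalingLimitAt x :=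
  fun h => hfill.not_convergesInLawToSLE hmiss hW (h D A B hAB)

/-- **The barrier's `blocks:` line as a theorem.** If in some Dobrushin domain `D` with an
endpoint approximation `(A, B)` the SAW laws are space-filling for EVERY supercritical fugacity
`x > x_c` (what Theorem 1 of the source gives for the unit disc, in the stronger hole-size form)
and chordal SLE_{8/3} in `D` misses a ball with positive probability, then the fugacity-robust
strengthening `RobustSAWScalingLimit` of the sub-problem is false: it would give SLE_{8/3}
convergence at some `x > x_c` (`RobustSAWScalingLimit.supercritical`).
[cite: DuminilCopinKozmaYadin2014, §1 and Theorem 1] -/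
theorem not_robustSAWScalingLimit_of_isSpaceFillingFamily (hAB : IsEndpointApprox D A B)
    (hfill : ∀ x : ℝ, criticalFugacity < x → IsSpaceFillingFamily x D.carrier A B)
    (hmiss : ∀ Γ : (ℝ≥0 → ℝ) → Literature.Probability.RandomPlanarGeometry.CurveClass ℂ, Literature.Probability.RandomPlanarGeometry.IsSLECurve ((8 : ℝ≥0) / 3) D Γ →
      ∃ z : ℂ, ∃ r : ℝ, 0 < r ∧ ball z r ⊆ D.carrier ∧
        Literature.Probability.Process.preWienerMeasure {ω | Disjoint (ball z (2 * r)) (Γ ω).range} ≠ 0)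
    (hW : Literature.Probability.Process.isProjectiveLimit_preWienerMeasure) : ¬ RobustSAWScalingLimit := by
  intro h
  obtain ⟨x, hx, hlim⟩ := h.supercritical
  exact not_sawScalingLimitAt_of_isSpaceFillingFamily hAB (hfill x hx) hmiss hW hlim

/-- The carrier of the library's unit disc `DobrushinDomain.unitDisc` (marked points `1, -1`) is
the unit disk `𝔻` of Theorem 1. [cite: DuminilCopinKozmaYadin2014, Theorem 1] -/
theorem carrier_unitDisc : Literature.Probability.RandomPlanarGeometry.DobrushinDomain.unitDisc.carrier = unitDisk := rfl

/-- **The setting of Theorem 1.** In the unit disc `𝔻` with marked points `1, -1`: if the lattice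
endpoints `A δ, B δ` form an endpoint approximation, the SAW laws with every parameter `x > x_c`
from `A δ` to `B δ` are space-filling in `𝔻` in the weak sense of §1 (the content of Theorem 1
for the closest sites `a_δ, b_δ`, after the lattice-geometric step "a macroscopic unvisited ball
is a hole of `≍ δ⁻²` sites"), and chordal SLE_{8/3} in `(𝔻; 1, -1)` misses a ball with positive
probability, then `RobustSAWScalingLimit` is false. [cite: DuminilCopinKozmaYadin2014, Theorem 1] -/
theorem not_robustSAWScalingLimit_of_unitDisc {A B : ℝ → Site 2}
    (hAB : IsEndpointApprox Literature.Probability.RandomPlanarGeometry.DobrushinDomain.unitDisc A B)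
    (hfill : ∀ x : ℝ, criticalFugacity < x → IsSpaceFillingFamily x unitDisk A B)
    (hmiss : ∀ Γ : (ℝ≥0 → ℝ) → Literature.Probability.RandomPlanarGeometry.CurveClass ℂ, Literature.Probability.RandomPlanarGeometry.IsSLECurve ((8 : ℝ≥0) / 3) Literature.Probability.RandomPlanarGeometry.DobrushinDomain.unitDisc Γ →
      ∃ z : ℂ, ∃ r : ℝ, 0 < r ∧ ball z r ⊆ unitDisk ∧
        Literature.Probability.Process.preWienerMeasure {ω | Disjoint (ball z (2 * r)) (Γ ω).range} ≠ 0)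
    (hW : Literature.Probability.Process.isProjectiveLimit_preWienerMeasure) : ¬ RobustSAWScalingLimit :=
  not_robustSAWScalingLimit_of_isSpaceFillingFamily (D := Literature.Probability.RandomPlanarGeometry.DobrushinDomain.unitDisc) hAB hfill hmiss hW

end Core

end Literature.Barriers.CriticalPhenomena.SupercriticalSAW
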